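import Summits.CriticalPhenomena.PercolationContinuityZ3.Theorems.PercNearOneGluingNoHeavyLowerTailApexTwoSumSums
import Summits.CriticalPhenomena.PercolationContinuityZ3.Theorems.PercNearOneGluingNoHeavyLowerTailThetaBlocks
import HarnessLib

/-!
# `NoHeavyLowerTail` (stmt-CriticalPhenomena-4575) — 2-SUMS THROUGH THE APEX FOR R1 AT THE MEASURE LEVEL:
# R1 on the arms (+ FKG on the arms) ⟹ R1 on the graph glued along `{a, h}`, for every `φ_{𝐩,q}`, every `q > 0`

Support file (prover prim-gen-kcluster gen 72; `--supports stmt-CriticalPhenomena-4575`).  No definitions, no named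
facts, no sorries.  This is the kernel MEASURE-LEVEL form of KCLUSTER-gen65 Corollary A ("a minimal counterexample to
R1-RC(q ≥ 1) has no apex–hub pair `{a, h}` separating `b` from `c`"), whose algebraic core is the kernel certificate
`ThetaBlocks.R10_cert` (p367913): here the arm dictionary is proved for configurations and random-cluster measures.

SETTING.  Finite vertex type `V`; apex `a`, hub `h`, terminals `b, c` (all distinct); two edge supports `DX DY :
Finset (Sym2 V)` (the ARMS) MEETING ONLY IN `{a, h}`, with `b` private to `DX` and `c` private to `DY`; parameters
`w : Sym2 V → [0,1]` vanishing off `DX ∪ DY`, `wX = w·1_{DX}`, `wY = w·1_{DXᶜ}`; `φ = rcMeasureW w q ∅`,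
`φ_X = rcMeasureW wX q ∅`, `φ_Y = rcMeasureW wY q ∅` (free random-cluster measures, any `q > 0`).  Three-point cells of an
instance `(a; s, t)` with support `D` (clusters `Gladkov.cl`, support separation `RefinedRowR3.Sep`, as in `SepDual`, `RCFolding`,
`ThreeSum`): `T = {s, t ∈ C(a)}`, `U_s = {s ∈ C(a), t ∉ C(a)}`, `U_t`, `S_D = {s, t ∉ C(a), C(a) meets every s–t path of D}`,
`U_a = {s, t ∉ C(a), t ∈ C(s)}`, `E = {a, s, t pairwise apart}`.  Rows: **R1** `φ(T) φ(S_D) ≤ φ(U_s) φ(U_t)`;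
**FKG slack** `φ(U_t)(φ(U_s) + φ(U_a)) ≤ φ(T) φ(E)` (an instance of positive association: `P(s joins a hub | a ~ t) ≥
P(s joins a hub | a ≁ t)` for the hubs `a, t`; automatic for `q ≥ 1`, `rcMeasureW_fkg`).

**THEOREM** (`ApexTwoSum.r1_of_apexTwoSum`).  If `φ_X` satisfies R1 and the FKG slack for the instance `(a; b, h)` (support
`DX`), `φ_Y` satisfies them for `(a; c, h)` (support `DY`), and the arms are non-degenerate (`φ_X(b, h ∈ C(a)) ≠ 0`,
`φ_Y(c, h ∈ C(a)) ≠ 0`), then `φ` satisfies R1 for `(a; b, c)` (support `D = DX ∪ DY`, given by its membership predicate).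

PROOF.  Parts 1–4 (`…ApexTwoSumGlue/Cells/Pointwise/Sums`) express the four masses of `φ`, times `q^{k^T(∅)}`, `T = {a,h}`,
as bilinear forms in the `T`-wired arm-cell masses (the DICTIONARY); the arm rows are the same inequalities between wired
masses (free mass = wired mass on `{h ∈ C(a)}`, `= q ·` wired mass on `{h ∉ C(a)}`); and `ThetaBlocks.R10_cert` with the free
arm masses `(A, B, qC, qD, qE, qN)` gives `A_X A_Y · q² · (U_b U_c − T S) ≥ 0` as a polynomial identity with non-negative
coefficients; non-degeneracy removes the factor `A_X A_Y`.  Consequences (part 6, `…ApexTwoSumFans`): with the pendant-terminal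
reduction, R1-RC(q ≥ 1) on fans and on wheels with the hub as apex.
-/

noncomputable section

namespace Summit.CriticalPhenomena.PercolationContinuityZ3.Theorems

namespace ApexTwoSum

open Finset SimpleGraph Literature.Probability.Percolation Literature.Probability.Percolation.Gladkov
open Literature.Probability.Percolation.BHK2006 (weight)
open Literature.Probability.Percolation.DecisionTree (ind ind_of_mem ind_of_not_mem ind_nonneg)
open Literature.Probability.LatticeModels RefinedRowR3 ThreePointLB MeasureTheory
open scoped Classical

variable {V : Type*} [Fintype V]

/-! ### Arm rows in wired masses -/

section Arm

variable {a h : V} (hah : a ≠ h) (u : Sym2 V → unitInterval) (q : ℝ)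
include hah

/-- On an event inside `{h ∈ C(a)}` the free mass is the `{a,h}`-wired mass. [this work] -/
theorem free_eq_wired {E : Set (BondConfig V)} (hE : ∀ η ∈ E, h ∈ cl η.toFinset a) :
    ∑ η : BondConfig V, rcWeightW u q ∅ η * ind E η = ∑ η : BondConfig V, rcWeightW u q ({a, h} : Set V) η * ind E η := by
  refine Finset.sum_congr rfl fun η _ => ?_
  by_cases hη : η ∈ E
  · unfold rcWeightW; rw [k_of_mem hah η (hE η hη)]
  · rw [ind_of_not_mem hη, mul_zero, mul_zero]

/-- On an event inside `{h ∉ C(a)}` the free mass is `q ·` the `{a,h}`-wired mass. [this work] -/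
theorem free_eq_q_wired {E : Set (BondConfig V)} (hE : ∀ η ∈ E, h ∉ cl η.toFinset a) :
    ∑ η : BondConfig V, rcWeightW u q ∅ η * ind E η = q * ∑ η : BondConfig V, rcWeightW u q ({a, h} : Set V) η * ind E η := by
  rw [Finset.mul_sum]
  refine Finset.sum_congr rfl fun η _ => ?_
  by_cases hη : η ∈ E
  · unfold rcWeightW; rw [k_of_not_mem hah η (hE η hη), pow_succ]; ring
  · rw [ind_of_not_mem hη, mul_zero, mul_zero, mul_zero]

end Arm

/-! ### The 2-sum theorem -/

section Main

variable {DX DY D : Finset (Sym2 V)} {a h b c : V} (hah : a ≠ h) (hab : a ≠ b) (hac : a ≠ c) (hbc : b ≠ c)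
  (hhb : h ≠ b) (hhc : h ≠ c)
  (hsepD : ∀ v : V, (∃ e ∈ DX, v ∈ e) → (∃ e ∈ DY, v ∈ e) → (v = a ∨ v = h))
  (hbY : ∀ e ∈ DY, b ∉ e) (hcX : ∀ e ∈ DX, c ∉ e) (hD : ∀ e, e ∈ D ↔ e ∈ DX ∨ e ∈ DY)
  (w wX wY : Sym2 V → unitInterval) {q : ℝ} (hq : 0 < q)
  (hw : ∀ e, e ∉ (↑DX ∪ ↑DY : Set (Sym2 V)) → (w e : ℝ) = 0)
  (hX : ∀ e ∈ (↑DX : Set (Sym2 V)), wX e = w e) (hX' : ∀ e ∉ (↑DX : Set (Sym2 V)), wX e = 0)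
  (hY : ∀ e ∈ (↑DX : Set (Sym2 V)), wY e = 0) (hY' : ∀ e ∉ (↑DX : Set (Sym2 V)), wY e = w e)
include hah hab hac hbc hhb hhc hsepD hbY hcX hD hq hw hX hX' hY hY'

/-- **The 2-sum theorem through the apex for R1, measure level** (every `q > 0`): if the free random-cluster
measures of the two arms of a graph glued along `{a, h}` satisfy R1 and the FKG slack for the instances `(a; b, h)` and
`(a; c, h)` and are non-degenerate, then the free random-cluster measure of the glued graph satisfies R1 for `(a; b, c)`:
`φ(T)·φ(S) ≤ φ(U_b)·φ(U_c)`. [this work] -/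
theorem r1_of_apexTwoSum
    (hR1X : (rcMeasureW wX q ∅).real {η : BondConfig V | b ∈ cl η.toFinset a ∧ h ∈ cl η.toFinset a} * (rcMeasureW wX q ∅).real {η : BondConfig V | b ∉ cl η.toFinset a ∧ h ∉ cl η.toFinset a ∧ Sep DX (cl η.toFinset a) b h} ≤ (rcMeasureW wX q ∅).real {η : BondConfig V | b ∈ cl η.toFinset a ∧ h ∉ cl η.toFinset a} * (rcMeasureW wX q ∅).real {η : BondConfig V | b ∉ cl η.toFinset a ∧ h ∈ cl η.toFinset a})
    (hFX : (rcMeasureW wX q ∅).real {η : BondConfig V | b ∉ cl η.toFinset a ∧ h ∈ cl η.toFinset a} * ((rcMeasureW wX q ∅).real {η : BondConfig V | b ∈ cl η.toFinset a ∧ h ∉ cl η.toFinset a} + (rcMeasureW wX q ∅).real {η : BondConfig V | b ∉ cl η.toFinset a ∧ h ∉ cl η.toFinset a ∧ h ∈ cl η.toFinset b}) ≤ (rcMeasureW wX q ∅).real {η : BondConfig V | b ∈ cl η.toFinset a ∧ h ∈ cl η.toFinset a} * (rcMeasureW wX q ∅).real {η : BondConfig V | b ∉ cl η.toFinset a ∧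 h ∉ cl η.toFinset a ∧ h ∉ cl η.toFinset b})
    (hAX : (rcMeasureW wX q ∅).real {η : BondConfig V | b ∈ cl η.toFinset a ∧ h ∈ cl η.toFinset a} ≠ 0)
    (hR1Y : (rcMeasureW wY q ∅).real {η : BondConfig V | c ∈ cl η.toFinset a ∧ h ∈ cl η.toFinset a} * (rcMeasureW wY q ∅).real {η : BondConfig V | c ∉ cl η.toFinset a ∧ h ∉ cl η.toFinset a ∧ Sep DY (cl η.toFinset a) c h} ≤ (rcMeasureW wY q ∅).real {η : BondConfig V | c ∈ cl η.toFinset a ∧ h ∉ cl η.toFinset a} * (rcMeasureW wY q ∅).real {η : BondConfig V | c ∉ cl η.toFinset a ∧ h ∈ cl η.toFinset a})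
    (hFY : (rcMeasureW wY q ∅).real {η : BondConfig V | c ∉ cl η.toFinset a ∧ h ∈ cl η.toFinset a} * ((rcMeasureW wY q ∅).real {η : BondConfig V | c ∈ cl η.toFinset a ∧ h ∉ cl η.toFinset a} + (rcMeasureW wY q ∅).real {η : BondConfig V | c ∉ cl η.toFinset a ∧ h ∉ cl η.toFinset a ∧ h ∈ cl η.toFinset c}) ≤ (rcMeasureW wY q ∅).real {η : BondConfig V | c ∈ cl η.toFinset a ∧ h ∈ cl η.toFinset a} * (rcMeasureW wY q ∅).real {η : BondConfig V | c ∉ cl η.toFinset a ∧ h ∉ cl η.toFinset a ∧ h ∉ cl η.toFinset c})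
    (hAY : (rcMeasureW wY q ∅).real {η : BondConfig V | c ∈ cl η.toFinset a ∧ h ∈ cl η.toFinset a} ≠ 0) :
    (rcMeasureW w q ∅).real {η : BondConfig V | b ∈ cl η.toFinset a ∧ c ∈ cl η.toFinset a} * (rcMeasureW w q ∅).real {η : BondConfig V | b ∉ cl η.toFinset a ∧ c ∉ cl η.toFinset a ∧ Sep D (cl η.toFinset a) b c} ≤ (rcMeasureW w q ∅).real {η : BondConfig V | b ∈ cl η.toFinset a ∧ c ∉ cl η.toFinset a} * (rcMeasureW w q ∅).real {η : BondConfig V | b ∉ cl η.toFinset a ∧ c ∈ cl η.toFinset a} := by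
  -- supports of the arms and of the glued graph
  have hwX : ∀ e, e ∉ (↑DX : Set (Sym2 V)) → (wX e : ℝ) = 0 := fun e he => by rw [hX' e he]; rfl
  have hDD : D = DX ∪ DY := by ext e; rw [Finset.mem_union]; exact hD e
  subst hDD
  -- positivity
  have hZ := rcPartitionFunctionW_pos w hq (∅ : Set V)
  have hZX := rcPartitionFunctionW_pos wX hq (∅ : Set V)
  have hZY := rcPartitionFunctionW_pos wY hq (∅ : Set V)
  have hK : 0 < q ^ clusterCount (∅ : BondConfig V) ({a, h} : Set V) := pow_pos hq _
  have hnn : ∀ (u : Sym2 V → unitInterval) (E : Set (BondConfig V)),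
      0 ≤ ∑ η : BondConfig V, rcWeightW u q ({a, h} : Set V) η * ind E η := fun u E =>
    Finset.sum_nonneg fun η _ => mul_nonneg (rcWeightW_nonneg u hq.le _ η) (ind_nonneg E η)
  -- measures as sums
  simp only [rcMeasureW_real_eq_sum_div w hq, rcMeasureW_real_eq_sum_div wX hq,
    rcMeasureW_real_eq_sum_div wY hq] at hR1X hFX hAX hR1Y hFY hAY ⊢
  -- the arm rows as inequalities of wired masses
  rw [free_eq_wired hah wX q (E := {η : BondConfig V | b ∈ cl η.toFinset a ∧ h ∈ cl η.toFinset a}) (fun η hη => hη.2), free_eq_q_wired hah wX q (E := {η : BondConfig V | b ∉ cl η.toFinset a ∧ h ∉ cl η.toFinset a ∧ Sep DX (cl η.toFinset a) b h}) (fun η hη => hη.2.1),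
    free_eq_q_wired hah wX q (E := {η : BondConfig V | b ∈ cl η.toFinset a ∧ h ∉ cl η.toFinset a}) (fun η hη => hη.2), free_eq_wired hah wX q (E := {η : BondConfig V | b ∉ cl η.toFinset a ∧ h ∈ cl η.toFinset a}) (fun η hη => hη.2)] at hR1X
  rw [free_eq_wired hah wX q (E := {η : BondConfig V | b ∉ cl η.toFinset a ∧ h ∈ cl η.toFinset a}) (fun η hη => hη.2), free_eq_q_wired hah wX q (E := {η : BondConfig V | b ∈ cl η.toFinset a ∧ h ∉ cl η.toFinset a}) (fun η hη => hη.2),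
    free_eq_q_wired hah wX q (E := {η : BondConfig V | b ∉ cl η.toFinset a ∧ h ∉ cl η.toFinset a ∧ h ∈ cl η.toFinset b}) (fun η hη => hη.2.1), free_eq_wired hah wX q (E := {η : BondConfig V | b ∈ cl η.toFinset a ∧ h ∈ cl η.toFinset a}) (fun η hη => hη.2),
    free_eq_q_wired hah wX q (E := {η : BondConfig V | b ∉ cl η.toFinset a ∧ h ∉ cl η.toFinset a ∧ h ∉ cl η.toFinset b}) (fun η hη => hη.2.1)] at hFX
  rw [free_eq_wired hah wX q (E := {η : BondConfig V | b ∈ cl η.toFinset a ∧ h ∈ cl η.toFinset a}) (fun η hη => hη.2)] at hAX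
  rw [free_eq_wired hah wY q (E := {η : BondConfig V | c ∈ cl η.toFinset a ∧ h ∈ cl η.toFinset a}) (fun η hη => hη.2), free_eq_q_wired hah wY q (E := {η : BondConfig V | c ∉ cl η.toFinset a ∧ h ∉ cl η.toFinset a ∧ Sep DY (cl η.toFinset a) c h}) (fun η hη => hη.2.1),
    free_eq_q_wired hah wY q (E := {η : BondConfig V | c ∈ cl η.toFinset a ∧ h ∉ cl η.toFinset a}) (fun η hη => hη.2), free_eq_wired hah wY q (E := {η : BondConfig V | c ∉ cl η.toFinset a ∧ h ∈ cl η.toFinset a}) (fun η hη => hη.2)] at hR1Y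
  rw [free_eq_wired hah wY q (E := {η : BondConfig V | c ∉ cl η.toFinset a ∧ h ∈ cl η.toFinset a}) (fun η hη => hη.2), free_eq_q_wired hah wY q (E := {η : BondConfig V | c ∈ cl η.toFinset a ∧ h ∉ cl η.toFinset a}) (fun η hη => hη.2),
    free_eq_q_wired hah wY q (E := {η : BondConfig V | c ∉ cl η.toFinset a ∧ h ∉ cl η.toFinset a ∧ h ∈ cl η.toFinset c}) (fun η hη => hη.2.1), free_eq_wired hah wY q (E := {η : BondConfig V | c ∈ cl η.toFinset a ∧ h ∈ cl η.toFinset a}) (fun η hη => hη.2),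
    free_eq_q_wired hah wY q (E := {η : BondConfig V | c ∉ cl η.toFinset a ∧ h ∉ cl η.toFinset a ∧ h ∉ cl η.toFinset c}) (fun η hη => hη.2.1)] at hFY
  rw [free_eq_wired hah wY q (E := {η : BondConfig V | c ∈ cl η.toFinset a ∧ h ∈ cl η.toFinset a}) (fun η hη => hη.2)] at hAY
  -- clear denominators in the goal and use the dictionary
  rw [div_mul_div_comm, div_mul_div_comm]
  refine div_le_div_of_nonneg_right ?_ (mul_pos hZ hZ).le
  refine le_of_mul_le_mul_right (a := q ^ clusterCount (∅ : BondConfig V) ({a, h} : Set V) * q ^ clusterCount (∅ : BondConfig V) ({a, h} : Set V)) ?_ (mul_pos hK hK)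
  have eT := glued_T_sum hah hab hac hsepD hbY hcX w wX wY q hw hX hX' hY hY'
  have eS := glued_S_sum hah hab hac hbc hhb hhc hsepD hbY hcX w wX wY q hw hX hX' hY hY'
  have eUb := glued_Ub_sum hah hab hac hsepD hbY hcX w wX wY q hw hX hX' hY hY'
  have eUc := glued_Uc_sum hah hab hac hsepD hbY hcX w wX wY q hw hX hX' hY hY'
  rw [show ∀ x y K : ℝ, x * y * (K * K) = (x * K) * (y * K) from fun x y K => by ring, eT, eS,
    show ∀ x y K : ℝ, x * y * (K * K) = (x * K) * (y * K) from fun x y K => by ring, eUb, eUc]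
  -- name the wired masses
  set XA := (∑ η : BondConfig V, rcWeightW wX q ({a, h} : Set V) η * ind {η : BondConfig V | b ∈ cl η.toFinset a ∧ h ∈ cl η.toFinset a} η) with hXA
  set XB := (∑ η : BondConfig V, rcWeightW wX q ({a, h} : Set V) η * ind {η : BondConfig V | b ∉ cl η.toFinset a ∧ h ∈ cl η.toFinset a} η) with hXB
  set XC := (∑ η : BondConfig V, rcWeightW wX q ({a, h} : Set V) η * ind {η : BondConfig V | b ∈ cl η.toFinset a ∧ h ∉ cl η.toFinset a} η) with hXC
  set XD := (∑ η : BondConfig V, rcWeightW wX q ({a, h} : Set V) η * ind {η : BondConfig V | b ∉ cl η.toFinset a ∧ h ∉ cl η.toFinset a ∧ h ∈ cl η.toFinset b} η) with hXD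
  set XE := (∑ η : BondConfig V, rcWeightW wX q ({a, h} : Set V) η * ind {η : BondConfig V | b ∉ cl η.toFinset a ∧ h ∉ cl η.toFinset a ∧ h ∉ cl η.toFinset b} η) with hXE
  set XN := (∑ η : BondConfig V, rcWeightW wX q ({a, h} : Set V) η * ind {η : BondConfig V | b ∉ cl η.toFinset a ∧ h ∉ cl η.toFinset a ∧ Sep DX (cl η.toFinset a) b h} η) with hXN
  set YA := (∑ η : BondConfig V, rcWeightW wY q ({a, h} : Set V) η * ind {η : BondConfig V | c ∈ cl η.toFinset a ∧ h ∈ cl η.toFinset a} η) with hYA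
  set YB := (∑ η : BondConfig V, rcWeightW wY q ({a, h} : Set V) η * ind {η : BondConfig V | c ∉ cl η.toFinset a ∧ h ∈ cl η.toFinset a} η) with hYB
  set YC := (∑ η : BondConfig V, rcWeightW wY q ({a, h} : Set V) η * ind {η : BondConfig V | c ∈ cl η.toFinset a ∧ h ∉ cl η.toFinset a} η) with hYC
  set YD := (∑ η : BondConfig V, rcWeightW wY q ({a, h} : Set V) η * ind {η : BondConfig V | c ∉ cl η.toFinset a ∧ h ∉ cl η.toFinset a ∧ h ∈ cl η.toFinset c} η) with hYD
  set YE := (∑ η : BondConfig V, rcWeightW wY q ({a, h} : Set V) η * ind {η : BondConfig V | c ∉ cl η.toFinset a ∧ h ∉ cl η.toFinset a ∧ h ∉ cl η.toFinset c} η) with hYE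
  set YN := (∑ η : BondConfig V, rcWeightW wY q ({a, h} : Set V) η * ind {η : BondConfig V | c ∉ cl η.toFinset a ∧ h ∉ cl η.toFinset a ∧ Sep DY (cl η.toFinset a) c h} η) with hYN
  -- the raw rows
  have hZX2 : 0 < rcPartitionFunctionW wX q ∅ * rcPartitionFunctionW wX q ∅ := mul_pos hZX hZX
  have hZY2 : 0 < rcPartitionFunctionW wY q ∅ * rcPartitionFunctionW wY q ∅ := mul_pos hZY hZY
  have ρX : 0 ≤ XB * (q * XC) - XA * (q * XN) := by
    rw [div_mul_div_comm, div_mul_div_comm, div_le_div_iff_of_pos_right hZX2] at hR1X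
    linarith
  have φX : 0 ≤ XA * (q * XE) - XB * (q * XC + q * XD) := by
    rw [← add_div, div_mul_div_comm, div_mul_div_comm, div_le_div_iff_of_pos_right hZX2] at hFX
    linarith
  have ρY : 0 ≤ YB * (q * YC) - YA * (q * YN) := by
    rw [div_mul_div_comm, div_mul_div_comm, div_le_div_iff_of_pos_right hZY2] at hR1Y
    linarith
  have φY : 0 ≤ YA * (q * YE) - YB * (q * YC + q * YD) := by
    rw [← add_div, div_mul_div_comm, div_mul_div_comm, div_le_div_iff_of_pos_right hZY2] at hFY
    linarith
  have pXA : 0 < XA := lt_of_le_of_ne (hnn _ _) (fun h0 => hAX (by rw [← h0, zero_div]))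
  have pYA : 0 < YA := lt_of_le_of_ne (hnn _ _) (fun h0 => hAY (by rw [← h0, zero_div]))
  -- the certificate
  have cert := ThetaBlocks.R10_cert XA XB (q * XC) (q * XD) (q * XE) (q * XN) YA YB (q * YC) (q * YD) (q * YE) (q * YN) q
    (hnn _ _) (hnn _ _) (mul_nonneg hq.le (hnn _ _)) (mul_nonneg hq.le (hnn _ _)) (hnn _ _) (hnn _ _)
    (mul_nonneg hq.le (hnn _ _)) (mul_nonneg hq.le (hnn _ _)) hq.le
    _ _ _ _ rfl rfl rfl rfl φX ρX φY ρY
    _ _ _ _ _ rfl rfl rfl rfl rfl _ _ _ _ rfl rfl rfl rfl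
  have hpos : 0 < XA * YA * q ^ 2 := by positivity
  refine le_of_mul_le_mul_left (a := XA * YA * q ^ 2) ?_ hpos
  have key : XA * YA * q ^ 2 * ((XA * YB + XA * YE + XC * YB + q * (XC * YD) + q * (XC * YE) + XD * YB) * (XB * YA + XE * YA + XB * YC + q * (XD * YC) + q * (XE * YC) + XB * YD)) - XA * YA * q ^ 2 * ((XA * YA + XA * YC + XA * YD + XC * YA + q * (XC * YC) + XD * YA) * (XB * YB + XB * YE + XE * YB + q * (XN * YD) + q * (XN * YE) + q * (XD * YN) + q * (XE * YN) - q * (XN * YN))) =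
      XA * YA * ((q * XA * (YA + YB) + XA * (q * YC + q * YD + q * YE) + (q * XC + q * XD) * (YA + YB) + q * XC * (q * YC + q * YD + q * YE)) * (q * YA * (XA + XB) + YA * (q * XC + q * XD + q * XE) + (q * YC + q * YD) * (XA + XB) + q * YC * (q * XC + q * XD + q * XE)) - (q * XA * YA + XA * (q * YC + q * YD) + (q * XC + q * XD) * YA + q * XC * (q * YC)) * ((q * (XA + XB) * (YA + YB) + (XA + XB) * (q * YC + q * YD + q * YE) + (q * XC + q * XD + q * XE) * (YA + YB) + (q * XC + q * XD + q * XE) * (q * YC + q * YD + q * YE)) - ((q * XC + q * XD + q * XE) - q * XC - q * XN) * ((q * YC + q * YD + q * YE) - q * YC - q * YN))) := by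
    ring
  linarith [cert, key]

end Main

end ApexTwoSum

end Summit.CriticalPhenomena.PercolationContinuityZ3.Theorems
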